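import Mathlib.Topology.Instances.Matrix
import Summits.QuantumFields.BalabanUV.Beta.FP.PerfectPropagatorSymbol
import Literature.MathematicalPhysics.QuantumFieldTheory.Balaban1983to89.Beta.PuncturedRiemannSum

/-!
# `BalabanUV.Beta.FP.PerfectPropagatorBound` — road «FP» for binder row D1, leaf H2-P of the horizontal route (owner ruling R-FP-15;
# `HOME/b2b-balaban-beta-d1-p3/H2-DESIGN.md` §5–§6), sub-row H2-P-BND = the INTEGRABILITY INPUT of the owner's row H2-P-KER:
# the unconstrained perfect propagator symbol `PinfSym` (p231001) is BOUNDED BY `1/(2γ₀·ε(s))` ENTRYWISE at the road's momentum factors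
# `d1Sym s = (a ↦ e^{i s_a} − 1)`, CONTINUOUS on the punctured real Brillouin zone, and INTEGRABLE on the zone for `d ≥ 3` — so the x-space
# kernel `P∞(z) = (2π)^{-d}∫_{BZ} PinfSym(s)(d1Sym s)·e^{is·z} ds` is an absolutely convergent Brillouin-zone integral in `d = 4`

HONEST DEPENDENCY (page 1, mandatory): continuum YM on T⁴ ⇐ BetaPertH ∧ nine spine estimates (0/9 proved); BetaPertH ⇐ (D1) ∧ (D4) ∧ CAP+tail;
G-an2-4 gates asym, D1 and NE2/3/4.  HONEST FRAMING (cell contract, verbatim): «discharging `BetaPertH` makes Bałaban's UV stability UNCONDITIONAL —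
a real constructive-QFT result; it is NOT the continuum limit and NOT the Clay problem.»  THIS MODULE DISCHARGES NOTHING of the wall: [folklore]
finite-dimensional linear algebra (Mathlib `Matrix`), uniform-limit continuity (Mathlib `TendstoUniformlyOn`) and ONE call of an5's punctured-zone
integrability lemma (`Beta.PuncturedRiemannSum.integrableOn_brillouin_of_norm_le_inv_dispersion`), over tree objects BY NAME (`FP/PerfectPropagatorSymbol`
p231001, `FP/PerfectMaxwellElliptic` p230467, `T4Rate166StripDirect.W166lim_rate`, `B5Symbol166Strip.differentiableAt_W166`).  No `def`, no `def … : Prop`,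
nothing cited as a hypothesis, 0 sorry; 0 wall binders; NOT D1, NOT BetaPertH, NOT continuum, NOT Clay.  «not in print; our bookkeeping».

ABSOLUTE RULE (cell charter, verbatim): «No internally-minted statement may enter as a cited fact. Every hypothesis is either kernel-proved in this package or a
verbatim quotation of a PUBLISHED theorem with page reference. The manuscript(s) under audit are NOT citable for their own disputed steps — they are the thing
under adjudication; programme-internal (2001/route/tribunal) claims are never citable.»

WHAT.
* §1 [folklore] QUANTITATIVE INVERSE OF A COERCIVE MATRIX: if `F * P = 1` and `γ·Σ_α‖w α‖² ≤ Re (quad F w)` for every `w` (`γ > 0`), then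
  **`sq_mul_sum_norm_sq_mulVec_le`**: `γ²·Σ_α‖(P v) α‖² ≤ Σ_α‖v α‖²` and **`norm_inv_entry_le`**: `‖P α β‖ ≤ 1/γ` (`w := P v`, `F w = v`,
  `γ‖w‖² ≤ Re w†Fw = Re⟨w,v⟩ ≤ ‖w‖‖v‖`, Cauchy–Schwarz = `PerfectMaxwellElliptic.inner_sq_le`).
* §2 [our object] THE INSTANCE `PinfSym` (the owner LEFT the operator-norm bound «in quadratic-form currency»): for `s ∈ BZ d` and `ph ≠ 0`,
  **`norm_PinfSym_le`**: `‖PinfSym s ph α β‖ ≤ 1/((4/π²)^{d+2}·Σ_μ‖ph μ‖²)` and the `ℓ²` form `sq_mul_sum_norm_sq_PinfSym_mulVec_le`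
  (`perfectFeynman_lower` + `quad_feynMat` + `feynMat_mul_PinfSym`).
* §3 [our object] AT THE ROAD's MOMENTUM FACTORS `ph := d1Sym s` (`d1Sym s a = e^{i s_a} − 1`, the letter of H2-P-DICT `PerfectMaxwellDict`):
  `sum_norm_d1Sym_sq`: `Σ_a‖d1Sym s a‖² = 2·ε(s)` (`ε = LatticeModels.dispersion`), `d1Sym_ne_zero` off the origin of the zone, hence
  **`norm_PinfSym_d1Sym_le`**: `‖PinfSym s (d1Sym s) α β‖ ≤ 1/(2·(4/π²)^{d+2}·ε(s))` and **`norm_PinfSym_d1Sym_le_inv_norm_sq`**: `≤ (π²/4)^{d+3}/‖s‖²`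
  (Jordan: `LatticeGreenFunction.mul_norm_sq_le_dispersion`).
* §4 [our object] CONTINUITY: `continuousOn_W166lim` (the continuum (1.66) multiplier is continuous on the closed strip `Strip d 0` — UNIFORM limit
  `W166lim_rate` of the differentiable `W166 (j+1)`), `continuousOn_W166Inf_ofReal_re` (its real part on the real zone), `continuous_feynMat`
  (the Feynman-completed weighted Maxwell matrix is jointly continuous in (weights, momentum factors)), **`continuousOn_PinfSym_d1Sym`**:
  `ContinuousOn (s ↦ PinfSym s (d1Sym s)) (BZ d ∖ {0})` (`continuousAt_matrix_inv` at a unit determinant).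
* §5 [our object] INTEGRABILITY (`3 ≤ d`; road: `d = 4`): **`integrableOn_PinfSym_d1Sym`**: every entry `s ↦ PinfSym s (d1Sym s) α β` is integrable on
  the zone (an5's lemma with `C₀ = 0`, `C₁ = 1/(2γ₀)`, `BZ = brillouin`), **`integrableOn_PinfSym_d1Sym_mul_cexp`** (times the lattice phase `e^{is·z}`) and
  **`integrableOn_integrand_of_eq_PinfSym`** (the `B4ContourShift.integrand` of ANY complex-momentum extension agreeing with `PinfSym s (d1Sym s) α β` on the
  zone) and `norm_latticeKernel_le_of_eq_PinfSym` (its lattice kernel is bounded UNIFORMLY in `z` by the `L¹` norm of the entry) — the integrability input of the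
  owner's row H2-P-KER (`LEAVES-FP.md`): the kernel DEFINITION, the split `δ/|p̂|² + B` and the GERM are NOT here.
Provenance: G-an2-4 swarm leaf prover 05, gen 34 (prover-b2b-balaban-gan24-formalise-leaf-05-g34-0), cross-lane on road FP (journal INTENT l.19329), 2026-08-20.
-/

noncomputable section

namespace Summit.QuantumFields.BalabanUV.Beta.FP.PerfectPropagatorBound

open MeasureTheory Filter Topology Finset Matrix Complex
open scoped BigOperators ComplexConjugate
open Literature.MathematicalPhysics.QuantumFieldTheory.Balaban1983to89
open Literature.Probability.LatticeModels (brillouin dispersion dispersion_nonneg mul_norm_sq_le_dispersion dispersion_pos_of_mem_brillouin)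
open Literature.MathematicalPhysics.QuantumFieldTheory.Balaban1983to89.Beta.PuncturedRiemannSum (integrableOn_brillouin_of_norm_le_inv_dispersion)
open B4Strip (Strip ofRealVec S1r)
open B4StripCauchy (Fat strip_subset_fat rOf rOf_pos rOf_le d_mul_rOf_sq_le)
open B4ContourShift (BZ phase integrand fourierBox latticeKernel ofRealVec_mem_Strip norm_cexp_phase continuous_ofRealVec)
open B5Prop11Fiber (d1Sym norm_d1Sym_sq)
open B5Symbol166 (W166)
open B5Symbol166Strip (kappa166 kappa166_pos differentiableAt_W166 F66_ne_zero_of_mem)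
open T4Rate166StripDirect (W166lim W166lim_rate C166 C166_pos)
open Summit.QuantumFields.BalabanUV.Beta.FP.PerfectSymbol166 (W166Inf W166lim_eq_W166Inf)
open Summit.QuantumFields.BalabanUV.Beta.FP.PerfectMaxwellSymbol (maxwellQ)
open Summit.QuantumFields.BalabanUV.Beta.FP.PerfectMaxwellElliptic (perfectFeynman_lower inner_sq_le)
open Summit.QuantumFields.BalabanUV.Beta.FP.PerfectPropagatorSymbol (curlRow maxwellMat feynMat quad PinfSym quad_eq_dotProduct quad_feynMat
  feynMat_mul_PinfSym isUnit_det_feynMat)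

variable {d : ℕ}

/-! ## §1 Quantitative inverse of a coercive matrix -/

/-- [folklore] `Re (star w ⬝ᵥ v) ≤ √(Σ‖w‖²)·√(Σ‖v‖²)` (Cauchy–Schwarz, in the road's explicit-sum currency). -/
theorem re_star_dotProduct_le (w v : Fin d → ℂ) :
    (star w ⬝ᵥ v).re ≤ Real.sqrt (∑ α, ‖w α‖ ^ 2) * Real.sqrt (∑ α, ‖v α‖ ^ 2) := by
  have hz : star w ⬝ᵥ v = ∑ α, v α * conj (w α) := by
    unfold dotProduct
    exact Finset.sum_congr rfl fun α _ => by simp only [Pi.star_apply, RCLike.star_def]; ring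
  have hCS := inner_sq_le v w
  have hre : (star w ⬝ᵥ v).re ≤ ‖∑ α, v α * conj (w α)‖ := by rw [hz]; exact Complex.re_le_norm _
  have hA : 0 ≤ ∑ α, ‖w α‖ ^ 2 := Finset.sum_nonneg fun _ _ => sq_nonneg _
  have hB : 0 ≤ ∑ α, ‖v α‖ ^ 2 := Finset.sum_nonneg fun _ _ => sq_nonneg _
  have hn : ‖∑ α, v α * conj (w α)‖ ≤ Real.sqrt (∑ α, ‖w α‖ ^ 2) * Real.sqrt (∑ α, ‖v α‖ ^ 2) := by
    rw [← Real.sqrt_mul hA, ← Real.sqrt_sq (norm_nonneg _)]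
    exact Real.sqrt_le_sqrt (by rw [mul_comm]; exact hCS)
  exact hre.trans hn

/-- [folklore] **QUANTITATIVE INVERSE OF A COERCIVE MATRIX, `ℓ²` FORM**: `F * P = 1` and `γ·Σ‖w‖² ≤ Re (quad F w)` for all `w` (`γ > 0`) ⟹
`γ²·Σ_α‖(P *ᵥ v) α‖² ≤ Σ_α‖v α‖²`. -/
theorem sq_mul_sum_norm_sq_mulVec_le {F P : Matrix (Fin d) (Fin d) ℂ} (hFP : F * P = 1) {γ : ℝ} (hγ : 0 < γ)
    (hcoer : ∀ w : Fin d → ℂ, γ * ∑ α, ‖w α‖ ^ 2 ≤ (quad F w).re) (v : Fin d → ℂ) :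
    γ ^ 2 * ∑ α, ‖(P *ᵥ v) α‖ ^ 2 ≤ ∑ α, ‖v α‖ ^ 2 := by
  set w : Fin d → ℂ := P *ᵥ v with hw
  have hFw : F *ᵥ w = v := by rw [hw, Matrix.mulVec_mulVec, hFP, Matrix.one_mulVec]
  have hq : quad F w = star w ⬝ᵥ v := by rw [quad_eq_dotProduct, hFw]
  set A : ℝ := ∑ α, ‖w α‖ ^ 2 with hA
  set B : ℝ := ∑ α, ‖v α‖ ^ 2 with hB
  have hA0 : 0 ≤ A := Finset.sum_nonneg fun _ _ => sq_nonneg _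
  have hB0 : 0 ≤ B := Finset.sum_nonneg fun _ _ => sq_nonneg _
  have h1 : γ * A ≤ Real.sqrt A * Real.sqrt B := by
    have := hcoer w; rw [hq] at this; exact this.trans (re_star_dotProduct_le w v)
  -- `γ√A ≤ √B`
  have h2 : γ * Real.sqrt A ≤ Real.sqrt B := by
    by_cases hA' : Real.sqrt A = 0
    · rw [hA', mul_zero]; exact Real.sqrt_nonneg _
    · have hpos : 0 < Real.sqrt A := lt_of_le_of_ne (Real.sqrt_nonneg _) (Ne.symm hA')
      have : γ * Real.sqrt A * Real.sqrt A ≤ Real.sqrt B * Real.sqrt A := by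
        rw [mul_assoc, Real.mul_self_sqrt hA0, mul_comm (Real.sqrt B)]; exact h1
      exact le_of_mul_le_mul_right this hpos
  have h3 : (γ * Real.sqrt A) ^ 2 ≤ (Real.sqrt B) ^ 2 :=
    pow_le_pow_left₀ (mul_nonneg hγ.le (Real.sqrt_nonneg _)) h2 2
  rw [mul_pow, Real.sq_sqrt hA0, Real.sq_sqrt hB0] at h3
  exact h3

/-- [folklore] **QUANTITATIVE INVERSE OF A COERCIVE MATRIX, ENTRYWISE**: under the same hypotheses `‖P α β‖ ≤ 1/γ`. -/
theorem norm_inv_entry_le {F P : Matrix (Fin d) (Fin d) ℂ} (hFP : F * P = 1) {γ : ℝ} (hγ : 0 < γ)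
    (hcoer : ∀ w : Fin d → ℂ, γ * ∑ α, ‖w α‖ ^ 2 ≤ (quad F w).re) (α β : Fin d) :
    ‖P α β‖ ≤ 1 / γ := by
  have h := sq_mul_sum_norm_sq_mulVec_le hFP hγ hcoer (Pi.single β 1)
  have hcol : (P *ᵥ Pi.single β 1) = fun i => P i β := by
    rw [Matrix.mulVec_single_one]; rfl
  have hone : ∑ α', ‖(Pi.single β (1 : ℂ) : Fin d → ℂ) α'‖ ^ 2 = 1 := by
    rw [Finset.sum_eq_single β]
    · simp
    · intro b _ hb; simp [hb]
    · intro h; exact absurd (Finset.mem_univ β) h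
  rw [hcol, hone] at h
  have hle : γ ^ 2 * ‖P α β‖ ^ 2 ≤ 1 :=
    le_trans (mul_le_mul_of_nonneg_left (Finset.single_le_sum (fun i _ => sq_nonneg ‖P i β‖) (Finset.mem_univ α)) (sq_nonneg γ)) h
  have hsq : (γ * ‖P α β‖) ^ 2 ≤ 1 := by rw [mul_pow]; exact hle
  have habs : γ * ‖P α β‖ ≤ 1 :=
    (pow_le_one_iff_of_nonneg (mul_nonneg hγ.le (norm_nonneg _)) two_ne_zero).1 hsq
  rw [le_div_iff₀ hγ, mul_comm]; exact habs

/-! ## §2 The instance: the unconstrained perfect propagator symbol -/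

/-- [our object] COERCIVITY OF THE FEYNMAN-COMPLETED PERFECT SYMBOL IN `quad` CURRENCY: at `s ∈ BZ d`,
`(4/π²)^{d+2}·(Σ‖ph‖²)·Σ‖w‖² ≤ Re (quad (feynMat (Re W_∞(·,·;s)) ph) w)` (`perfectFeynman_lower` + `quad_feynMat`). -/
theorem re_quad_feynMat_ge {s : Fin d → ℝ} (hs : s ∈ BZ d) (ph w : Fin d → ℂ) :
    (4 / Real.pi ^ 2) ^ (d + 2) * (∑ μ, ‖ph μ‖ ^ 2) * ∑ α, ‖w α‖ ^ 2
      ≤ (quad (feynMat (fun μ ν => (W166Inf μ ν (ofRealVec s)).re) ph) w).re := by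
  rw [quad_feynMat, Complex.ofReal_re, mul_assoc]
  exact perfectFeynman_lower hs ph w

/-- [folklore] `ph ≠ 0` ⟹ `0 < Σ‖ph μ‖²`. -/
theorem sum_norm_sq_pos {ph : Fin d → ℂ} (hph : ph ≠ 0) : 0 < ∑ μ, ‖ph μ‖ ^ 2 := by
  obtain ⟨a, ha⟩ : ∃ a, ph a ≠ 0 := by
    by_contra hall; push Not at hall; exact hph (funext hall)
  exact lt_of_lt_of_le (by positivity : (0:ℝ) < ‖ph a‖ ^ 2)
    (Finset.single_le_sum (fun i _ => sq_nonneg ‖ph i‖) (Finset.mem_univ a))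

/-- [our object] **THE `ℓ²` BOUND OF THE UNCONSTRAINED PERFECT PROPAGATOR SYMBOL**: for `s ∈ BZ d`, `ph ≠ 0` and every `v`,
`((4/π²)^{d+2}·Σ‖ph‖²)²·Σ_α‖(PinfSym s ph *ᵥ v) α‖² ≤ Σ_α‖v α‖²`. -/
theorem sq_mul_sum_norm_sq_PinfSym_mulVec_le {s : Fin d → ℝ} (hs : s ∈ BZ d) {ph : Fin d → ℂ} (hph : ph ≠ 0) (v : Fin d → ℂ) :
    ((4 / Real.pi ^ 2) ^ (d + 2) * ∑ μ, ‖ph μ‖ ^ 2) ^ 2 * ∑ α, ‖(PinfSym s ph *ᵥ v) α‖ ^ 2 ≤ ∑ α, ‖v α‖ ^ 2 :=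
  sq_mul_sum_norm_sq_mulVec_le (feynMat_mul_PinfSym hs hph) (mul_pos (by positivity) (sum_norm_sq_pos hph))
    (fun w => re_quad_feynMat_ge hs ph w) v

/-- [our object] **THE ENTRYWISE BOUND OF THE UNCONSTRAINED PERFECT PROPAGATOR SYMBOL** (the operator-norm statement `‖P∞sym‖ ≤ 1/(γ|p̂|²)` of
`PerfectPropagatorSymbol`'s header, in matrix currency): for `s ∈ BZ d`, `ph ≠ 0`, `‖PinfSym s ph α β‖ ≤ 1/((4/π²)^{d+2}·Σ_μ‖ph μ‖²)`. -/
theorem norm_PinfSym_le {s : Fin d → ℝ} (hs : s ∈ BZ d) {ph : Fin d → ℂ} (hph : ph ≠ 0) (α β : Fin d) :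
    ‖PinfSym s ph α β‖ ≤ 1 / ((4 / Real.pi ^ 2) ^ (d + 2) * ∑ μ, ‖ph μ‖ ^ 2) :=
  norm_inv_entry_le (feynMat_mul_PinfSym hs hph) (mul_pos (by positivity) (sum_norm_sq_pos hph))
    (fun w => re_quad_feynMat_ge hs ph w) α β

/-! ## §3 At the road's momentum factors `d1Sym s = (a ↦ e^{i s_a} − 1)` -/

/-- [folklore] `Σ_a‖e^{i s_a} − 1‖² = 2·ε(s)` (`‖d1Sym s a‖² = 2 − 2cos s_a`, `ε(s) = Σ_a (1 − cos s_a)`). -/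
theorem sum_norm_d1Sym_sq (s : Fin d → ℝ) : ∑ a, ‖d1Sym s a‖ ^ 2 = 2 * dispersion s := by
  unfold dispersion
  rw [Finset.mul_sum]
  exact Finset.sum_congr rfl fun a _ => by rw [norm_d1Sym_sq]; unfold S1r; ring

/-- [folklore] the lineage's zone `BZ d` is the lattice-models `brillouin d` (membership form). -/
theorem mem_brillouin_of_mem_BZ {s : Fin d → ℝ} (hs : s ∈ BZ d) : s ∈ brillouin d := by
  have : BZ d = brillouin d := by unfold BZ brillouin; rw [Set.pi_univ_Icc]
  rw [← this]; exact hs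

/-- [folklore] off the origin of the zone the dispersion is positive, so `d1Sym s ≠ 0`. -/
theorem d1Sym_ne_zero {s : Fin d → ℝ} (hs : s ∈ BZ d) (h0 : s ≠ 0) : d1Sym s ≠ 0 := by
  intro h
  have hpos := dispersion_pos_of_mem_brillouin (mem_brillouin_of_mem_BZ hs) h0
  have hsum := sum_norm_d1Sym_sq s
  rw [h] at hsum
  simp at hsum
  linarith

/-- [our object] **`‖PinfSym s (d1Sym s) α β‖ ≤ 1/(2·(4/π²)^{d+2}·ε(s))`** for `s ≠ 0` in the zone. -/
theorem norm_PinfSym_d1Sym_le {s : Fin d → ℝ} (hs : s ∈ BZ d) (h0 : s ≠ 0) (α β : Fin d) :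
    ‖PinfSym s (d1Sym s) α β‖ ≤ 1 / (2 * (4 / Real.pi ^ 2) ^ (d + 2) * dispersion s) := by
  have h := norm_PinfSym_le hs (d1Sym_ne_zero hs h0) α β
  rw [sum_norm_d1Sym_sq] at h
  calc ‖PinfSym s (d1Sym s) α β‖ ≤ 1 / ((4 / Real.pi ^ 2) ^ (d + 2) * (2 * dispersion s)) := h
    _ = 1 / (2 * (4 / Real.pi ^ 2) ^ (d + 2) * dispersion s) := by ring

/-- [our object] … hence `≤ (π²/4)^{d+3}/‖s‖²` (sup norm; Jordan's inequality `ε(s) ≥ (2/π²)‖s‖²` on the zone). -/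
theorem norm_PinfSym_d1Sym_le_inv_norm_sq {s : Fin d → ℝ} (hs : s ∈ BZ d) (h0 : s ≠ 0) (α β : Fin d) :
    ‖PinfSym s (d1Sym s) α β‖ ≤ (Real.pi ^ 2 / 4) ^ (d + 3) / ‖s‖ ^ 2 := by
  have h := norm_PinfSym_d1Sym_le hs h0 α β
  have hJ := mul_norm_sq_le_dispersion (mem_brillouin_of_mem_BZ hs)
  have hε := dispersion_pos_of_mem_brillouin (mem_brillouin_of_mem_BZ hs) h0
  have hs2 : 0 < ‖s‖ ^ 2 := by have := norm_pos_iff.2 h0; positivity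
  have hγ : 0 < (4 / Real.pi ^ 2 : ℝ) ^ (d + 2) := by positivity
  refine h.trans ?_
  rw [div_le_div_iff₀ (by positivity) hs2, one_mul]
  -- `‖s‖² ≤ (π²/4)^{d+3}·(2·(4/π²)^{d+2}·ε(s))`; use `(π²/4)^{d+3}·(4/π²)^{d+2} = π²/4` and `2ε ≥ (4/π²)‖s‖²`
  have hπ : (Real.pi ^ 2 / 4) * (4 / Real.pi ^ 2) = 1 := by field_simp
  have hprod : (Real.pi ^ 2 / 4) ^ (d + 3) * (4 / Real.pi ^ 2) ^ (d + 2) = Real.pi ^ 2 / 4 := by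
    rw [pow_succ, mul_assoc, mul_comm (Real.pi ^ 2 / 4) ((4 / Real.pi ^ 2) ^ (d + 2)), ← mul_assoc, ← mul_pow, hπ, one_pow, one_mul]
  calc ‖s‖ ^ 2 = Real.pi ^ 2 / 4 * (2 * (2 / Real.pi ^ 2 * ‖s‖ ^ 2)) := by field_simp; ring
    _ ≤ Real.pi ^ 2 / 4 * (2 * dispersion s) := by gcongr
    _ = ((Real.pi ^ 2 / 4) ^ (d + 3) * (4 / Real.pi ^ 2) ^ (d + 2)) * (2 * dispersion s) := by rw [hprod]
    _ = (Real.pi ^ 2 / 4) ^ (d + 3) * (2 * (4 / Real.pi ^ 2) ^ (d + 2) * dispersion s) := by ring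

/-! ## §4 Continuity on the punctured zone -/

/-- [folklore] each printed-level multiplier `W166 n μ ν` is continuous on the closed strip `Strip d 0` (it is complex-differentiable at every point of
the fat region, `B5Symbol166Strip.differentiableAt_W166`). -/
theorem continuousOn_W166 (n : ℕ) [NeZero n] (μ ν : Fin d) : ContinuousOn (fun p : Fin d → ℂ => W166 n μ ν p) (Strip d 0) := by
  intro p hp
  have hfat : p ∈ Fat d (rOf d) := strip_subset_fat (rOf_pos d).le (rOf_pos d).le hp
  exact (differentiableAt_W166 n (rOf_le d) (d_mul_rOf_sq_le d) hfat μ ν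
    (F66_ne_zero_of_mem n le_rfl (kappa166_pos d).le hp)).continuousAt.continuousWithinAt

/-- [folklore] KING's RATE IS UNIFORM ⟹ `W166 (j+1) μ ν → W166lim μ ν` UNIFORMLY on `Strip d 0` (`W166lim_rate`: `‖W166lim − W166 n‖ ≤ C₁₆₆/n²`). -/
theorem tendstoUniformlyOn_W166 (μ ν : Fin d) :
    TendstoUniformlyOn (fun j : ℕ => fun p : Fin d → ℂ => W166 (j + 1) μ ν p) (fun p => W166lim μ ν p) atTop (Strip d 0) := by
  rw [Metric.tendstoUniformlyOn_iff]
  intro ε hε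
  have hlim : Tendsto (fun j : ℕ => C166 d / ((j : ℝ) + 1)) atTop (𝓝 0) := by
    have h := tendsto_one_div_add_atTop_nhds_zero_nat.const_mul (C166 d)
    rw [mul_zero] at h
    refine h.congr fun j => ?_
    ring
  have hev := (tendsto_order.1 hlim).2 ε hε
  refine hev.mono fun j hj p hp => ?_
  rw [dist_eq_norm]
  have hrate := W166lim_rate le_rfl (kappa166_pos d).le hp μ ν (j + 1)
  have hj1 : (1 : ℝ) ≤ (j : ℝ) + 1 := by have : (0:ℝ) ≤ j := Nat.cast_nonneg j; linarith
  have hmono : C166 d / (((j + 1 : ℕ) : ℝ)) ^ 2 ≤ C166 d / ((j : ℝ) + 1) := by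
    rw [Nat.cast_add, Nat.cast_one]
    refine div_le_div_of_nonneg_left (C166_pos d).le (by positivity) ?_
    nlinarith
  exact lt_of_le_of_lt (hrate.trans hmono) hj

/-- [our object] **THE CONTINUUM (1.66) MULTIPLIER IS CONTINUOUS ON THE CLOSED STRIP `Strip d 0`** (uniform limit of continuous functions). -/
theorem continuousOn_W166lim (μ ν : Fin d) : ContinuousOn (fun p : Fin d → ℂ => W166lim μ ν p) (Strip d 0) :=
  (tendstoUniformlyOn_W166 μ ν).continuousOn (Frequently.of_forall fun j => continuousOn_W166 (j + 1) μ ν)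

/-- [our object] **`s ↦ Re W_∞(μ,ν; s)` IS CONTINUOUS ON THE REAL BRILLOUIN ZONE** (`W166Inf = W166lim` on the strip, `PerfectSymbol166.W166lim_eq_W166Inf`). -/
theorem continuousOn_W166Inf_ofReal_re (μ ν : Fin d) :
    ContinuousOn (fun s : Fin d → ℝ => (W166Inf μ ν (ofRealVec s)).re) (BZ d) := by
  have h1 : ContinuousOn (fun s : Fin d → ℝ => W166lim μ ν (ofRealVec s)) (BZ d) :=
    (continuousOn_W166lim μ ν).comp continuous_ofRealVec.continuousOn fun s hs => ofRealVec_mem_Strip le_rfl hs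
  have h2 : ContinuousOn (fun s : Fin d → ℝ => W166Inf μ ν (ofRealVec s)) (BZ d) :=
    h1.congr fun s hs => (W166lim_eq_W166Inf le_rfl (kappa166_pos d).le (ofRealVec_mem_Strip le_rfl hs) μ ν).symm
  exact Complex.continuous_re.comp_continuousOn h2

/-- [folklore] `s ↦ d1Sym s` is continuous. -/
theorem continuous_d1Sym : Continuous (fun s : Fin d → ℝ => d1Sym s) := by
  refine continuous_pi fun a => ?_
  unfold d1Sym
  exact ((Complex.continuous_ofReal.comp (continuous_apply a)).mul continuous_const).cexp.sub continuous_const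

/-- [folklore] the curl rows are jointly continuous in the momentum factors. -/
theorem continuous_curlRow (μ ν α : Fin d) : Continuous (fun ph : Fin d → ℂ => curlRow ph μ ν α) := by
  unfold curlRow
  refine Continuous.sub ?_ ?_
  · by_cases h : α = ν
    · simp only [h, if_true]; exact continuous_apply μ
    · simp only [h, if_false]; exact continuous_const
  · by_cases h : α = μ
    · simp only [h, if_true]; exact continuous_apply ν
    · simp only [h, if_false]; exact continuous_const

/-- [folklore] **THE FEYNMAN-COMPLETED WEIGHTED MAXWELL MATRIX IS JOINTLY CONTINUOUS in (weights, momentum factors)** (a polynomial in the coordinates). -/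
theorem continuous_feynMat : Continuous (fun x : (Fin d → Fin d → ℝ) × (Fin d → ℂ) => feynMat x.1 x.2) := by
  refine continuous_pi fun α => continuous_pi fun β => ?_
  show Continuous fun x : (Fin d → Fin d → ℝ) × (Fin d → ℂ) => maxwellMat x.1 x.2 α β + x.2 α * conj (x.2 β)
  have hph : ∀ a, Continuous fun x : (Fin d → Fin d → ℝ) × (Fin d → ℂ) => x.2 a := fun a => (continuous_apply a).comp continuous_snd
  have hW : ∀ μ ν, Continuous fun x : (Fin d → Fin d → ℝ) × (Fin d → ℂ) => x.1 μ ν :=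
    fun μ ν => (continuous_apply ν).comp ((continuous_apply μ).comp continuous_fst)
  refine Continuous.add ?_ ((hph α).mul (Complex.continuous_conj.comp (hph β)))
  unfold maxwellMat
  refine continuous_finsetSum _ fun μ _ => continuous_finsetSum _ fun ν _ => ?_
  by_cases hμν : μ = ν
  · simp only [hμν, if_true]; exact continuous_const
  · simp only [hμν, if_false]
    refine Continuous.mul ?_ ?_
    · exact Complex.continuous_ofReal.comp (continuous_const.mul (hW μ ν))
    · exact (Complex.continuous_conj.comp ((continuous_curlRow μ ν α).comp continuous_snd)).mul
        ((continuous_curlRow μ ν β).comp continuous_snd)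

/-- [our object] the Feynman-completed PERFECT symbol at the road's momentum factors is continuous on the real zone (matrix-valued). -/
theorem continuousOn_feynMat_d1Sym :
    ContinuousOn (fun s : Fin d → ℝ => feynMat (fun μ ν => (W166Inf μ ν (ofRealVec s)).re) (d1Sym s)) (BZ d) := by
  have hW : ContinuousOn (fun s : Fin d → ℝ => fun μ ν => (W166Inf μ ν (ofRealVec s)).re) (BZ d) :=
    continuousOn_pi.2 fun μ => continuousOn_pi.2 fun ν => continuousOn_W166Inf_ofReal_re μ ν
  have h := continuous_feynMat.comp_continuousOn (hW.prodMk continuous_d1Sym.continuousOn)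
  exact h

/-- [our object] **THE UNCONSTRAINED PERFECT PROPAGATOR SYMBOL IS CONTINUOUS ON THE PUNCTURED REAL ZONE** (matrix-valued): the completed symbol is
continuous there and its determinant is a unit (`isUnit_det_feynMat`), so `Matrix` inversion is continuous at it (`continuousAt_matrix_inv`). -/
theorem continuousOn_PinfSym_d1Sym : ContinuousOn (fun s : Fin d → ℝ => PinfSym s (d1Sym s)) (BZ d \ {0}) := by
  intro s hs
  have hsBZ : s ∈ BZ d := hs.1
  have hs0 : s ≠ 0 := fun h => hs.2 h
  have hF : ContinuousWithinAt (fun s' : Fin d → ℝ => feynMat (fun μ ν => (W166Inf μ ν (ofRealVec s')).re) (d1Sym s')) (BZ d \ {0}) s :=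
    (continuousOn_feynMat_d1Sym s hsBZ).mono fun x hx => hx.1
  obtain ⟨u, hu⟩ := isUnit_det_feynMat hsBZ (d1Sym_ne_zero hsBZ hs0)
  have hinv : ContinuousAt Ring.inverse (feynMat (fun μ ν => (W166Inf μ ν (ofRealVec s)).re) (d1Sym s)).det := by
    rw [← hu]; exact NormedRing.inverse_continuousAt u
  have hI := continuousAt_matrix_inv _ hinv
  have hcomp : ContinuousWithinAt
      (fun s' : Fin d → ℝ => (feynMat (fun μ ν => (W166Inf μ ν (ofRealVec s')).re) (d1Sym s'))⁻¹) (BZ d \ {0}) s :=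
    ContinuousAt.comp_continuousWithinAt
      (f := fun s' : Fin d → ℝ => feynMat (fun μ ν => (W166Inf μ ν (ofRealVec s')).re) (d1Sym s')) hI hF
  exact hcomp

/-- [our object] … and so is every entry `s ↦ PinfSym s (d1Sym s) α β`. -/
theorem continuousOn_PinfSym_d1Sym_apply (α β : Fin d) :
    ContinuousOn (fun s : Fin d → ℝ => PinfSym s (d1Sym s) α β) (BZ d \ {0}) :=
  (continuousOn_pi.1 ((continuousOn_pi.1 continuousOn_PinfSym_d1Sym) α)) β

/-! ## §5 Integrability on the zone (`3 ≤ d`) -/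

/-- [our object] **EVERY ENTRY OF THE UNCONSTRAINED PERFECT PROPAGATOR SYMBOL IS INTEGRABLE ON THE BRILLOUIN ZONE for `d ≥ 3`** (road: `d = 4`):
continuous off the origin with the integrable majorant `1/(2·(4/π²)^{d+2}·ε(s))` (an5 `PuncturedRiemannSum.integrableOn_brillouin_of_norm_le_inv_dispersion`). -/
theorem integrableOn_PinfSym_d1Sym (hd : 3 ≤ d) (α β : Fin d) :
    IntegrableOn (fun s : Fin d → ℝ => PinfSym s (d1Sym s) α β) (BZ d) volume := by
  have hBZ : BZ d = brillouin d := by unfold BZ brillouin; rw [Set.pi_univ_Icc]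
  rw [hBZ]
  refine integrableOn_brillouin_of_norm_le_inv_dispersion hd (C₀ := 0) (C₁ := 1 / (2 * (4 / Real.pi ^ 2) ^ (d + 2))) ?_ ?_
  · rw [← hBZ]; exact continuousOn_PinfSym_d1Sym_apply α β
  · intro p hp hp0
    rw [← hBZ] at hp
    rw [zero_add, div_div]
    exact norm_PinfSym_d1Sym_le hp hp0 α β

/-- [our object] … hence, for every lattice point `z`, the entry times the lattice phase `e^{i s·z}` is integrable on the zone — the integrand of the
x-space kernel `P∞(z)_{αβ} = (2π)^{-d}∫_{BZ} PinfSym(s)(d1Sym s)_{αβ}·e^{is·z} ds` (row H2-P-KER; the kernel itself is the owner's to define). -/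
theorem integrableOn_PinfSym_d1Sym_mul_cexp (hd : 3 ≤ d) (α β : Fin d) (z : Fin d → ℤ) :
    IntegrableOn (fun s : Fin d → ℝ => PinfSym s (d1Sym s) α β * cexp (I * phase s z)) (BZ d) volume := by
  have hcont : Continuous fun s : Fin d → ℝ => cexp (I * phase s z) := by
    unfold phase
    exact (continuous_const.mul (continuous_finsetSum _ fun μ _ =>
      (Complex.continuous_ofReal.comp (continuous_apply μ)).mul continuous_const)).cexp
  exact (integrableOn_PinfSym_d1Sym hd α β).mul_bdd (c := 1) hcont.aestronglyMeasurable
    (Eventually.of_forall fun s => (norm_cexp_phase s z).le)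

/-- [our object] **THE LATTICE-KERNEL INTEGRAND OF ANY COMPLEX-MOMENTUM EXTENSION IS INTEGRABLE** (`d ≥ 3`): if `G : (Fin d → ℂ) → ℂ` agrees with the entry
`PinfSym s (d1Sym s) α β` at every real momentum of the zone, then `B4ContourShift.integrand G z` is integrable on `BZ d` for every `z` — so
`B4ContourShift.latticeKernel G` is an honest Bochner integral there. -/
theorem integrableOn_integrand_of_eq_PinfSym (hd : 3 ≤ d) {G : (Fin d → ℂ) → ℂ} {α β : Fin d}
    (hG : ∀ s ∈ BZ d, G (ofRealVec s) = PinfSym s (d1Sym s) α β) (z : Fin d → ℤ) :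
    IntegrableOn (integrand G z) (BZ d) volume := by
  refine (integrableOn_PinfSym_d1Sym_mul_cexp hd α β z).congr_fun (fun s hs => ?_) (by unfold BZ; exact measurableSet_Icc)
  unfold integrand
  rw [hG s hs]

/-- [our object] **… AND ITS LATTICE KERNEL IS BOUNDED UNIFORMLY IN `z`** by the `L¹` norm of the entry on the zone:
`‖latticeKernel G z‖ ≤ (2π)^{-d}·∫_{BZ} ‖PinfSym s (d1Sym s) α β‖ ds` (finite by `integrableOn_PinfSym_d1Sym`; `‖e^{is·z}‖ = 1`). -/
theorem norm_latticeKernel_le_of_eq_PinfSym {G : (Fin d → ℂ) → ℂ} {α β : Fin d}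
    (hG : ∀ s ∈ BZ d, G (ofRealVec s) = PinfSym s (d1Sym s) α β) (z : Fin d → ℤ) :
    ‖latticeKernel G z‖ ≤ ((2 * Real.pi) ^ d)⁻¹ * ∫ s in BZ d, ‖PinfSym s (d1Sym s) α β‖ := by
  have hpos : (0 : ℝ) < (2 * Real.pi) ^ d := by positivity
  unfold latticeKernel fourierBox
  rw [norm_smul, Real.norm_eq_abs, abs_of_pos (inv_pos.mpr hpos)]
  refine mul_le_mul_of_nonneg_left ?_ (inv_pos.mpr hpos).le
  calc ‖∫ s in BZ d, integrand G z s‖ ≤ ∫ s in BZ d, ‖integrand G z s‖ := norm_integral_le_integral_norm _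
    _ = ∫ s in BZ d, ‖PinfSym s (d1Sym s) α β‖ := by
        refine setIntegral_congr_fun (by unfold BZ; exact measurableSet_Icc) fun s hs => ?_
        show ‖integrand G z s‖ = ‖PinfSym s (d1Sym s) α β‖
        unfold integrand
        rw [hG s hs, norm_mul, norm_cexp_phase, mul_one]

end Summit.QuantumFields.BalabanUV.Beta.FP.PerfectPropagatorBound

end
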